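import Literature.NumberTheory.Automorphic.BCDTModularityModPProofs
import Literature.NumberTheory.EllipticCurves.NewformsTwistPacketProofs
import Literature.NumberTheory.GaloisRepresentations.FramedRepTwist
import HarnessLib

/-!
# BCDT §2.2: modularity of `ρ̄` from the modularity of a quadratic twist — proofs

Topic `NumberTheory/Automorphic`; a `…Proofs` companion (theorems only: no definition, no named
fact, no instance; D-0026) of `Literature.NumberTheory.Automorphic.BCDTModularity`, landed by the
tenured seat of the named fact `Literature.NumberTheory.Automorphic.BCDT.theoremB`
(Breuil–Conrad–Diamond–Taylor 2001, Thm. B = Thm. 2.2.1) as a bottom-up step in the printed proof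
of that theorem:

* C. Breuil, B. Conrad, F. Diamond, R. Taylor, *On the modularity of elliptic curves over `ℚ`:
  wild 3-adic exercises*, J. Amer. Math. Soc. 14 (2001) [BCDTJAMS2001], §2.2, proof of
  Theorem 2.2.1, p. 860: *"Then up to equivalence and twisting by a quadratic character, one of the
  following possibilities can be attained"* — the cases 2–6 are proved for a normalised twist
  `ρ̄' = ρ̄ ⊗ χ` (`χ` quadratic), for which the paper produces a **modular elliptic curve `E / ℚ`
  with `E[5] ≅ ρ̄'`** ("We deduce that `E` is modular, so `ρ̄ ≅ ρ̄_{E,5}` is modular"); the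
  modularity of `ρ̄ = ρ̄' ⊗ χ` itself is then tacit ("modularity is invariant under twisting").

In the tree's wording of "`ρ̄` is modular" (`ModPGaloisRep.IsModular`: a newform `g` of some
level `M` and weight with `ρ̄` unramified and `charpoly ρ̄(Frob_p) ≡ X² − a_p(g) X + ε(p) p^{w−1}`
at **every** prime `p ∤ 5 M`) that tacit step has content: the newform `g` attached to the
twisted eigenform `f_E ⊗ ψ` (Atkin–Li) has a level `M ∣ N_E m²` which may lose primes of `N_E m`,
and at such primes nothing is known.  This file proves the step in the form BCDT need, from the
tree's proved newform theory (`NewformsTwistPacketProofs`: the twisted packet is a newform packet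
of a level `M` with `M ∣ N m²` and `N ∣ M m²`):

* `charpoly_smul_of_charpoly_eq_fin_two`, `FramedRep.charpoly_twist_of_charpoly_eq` — the
  characteristic polynomial of a twisted `2 × 2` matrix;
* `isModular_of_isNewform0_packet` — **an integral newform packet makes `ρ̄` modular**: if
  `g ∈ S₂(Γ₀(M))` is a newform with `a_p(g) = b_p ∈ ℤ` and `ρ̄` is unramified with
  `charpoly ρ̄(Frob_p) = X² − b_p X + p` for all primes `p ∤ M ℓ`, then `ρ̄` is modular (the second
  half of the tree's `IsModular.isModular_of_isTorsionGaloisRep`, `BCDTModularityModPProofs`,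
  verbatim: `g` lifted to `Γ₁(M)`, `λ` a prime of `𝓞_g` over `ℓ`);
* `IsModular.exists_isNewform0_packet` — **a modular elliptic curve gives such a packet** for every
  framed model `ρ̄` of `E[ℓ]` (level `N_E`, `b_p = a_p(E)`; the first half of the same theorem:
  Néron–Ogg–Shafarevich and the characteristic polynomial of Frobenius on `E[ℓ]`);
* `exists_isNewform0_packet_twist` — **the twist step**: from an integral packet of level `N` for
  `ρ̄`, a primitive quadratic Dirichlet character `ψ mod m` and a continuous character
  `χ : Γ_ℚ → 𝔽_ℓ^×` matching `ψ` (unramified at `p ∤ m`, `χ(Frob_p) = ψ(p)`), an integral packet for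
  `ρ̄ ⊗ χ` of a level `M` with `M ∣ N m²`, `N ∣ M m²` — **provided every prime `p ∣ m`, `p ≠ ℓ`,
  has `2 v_p(m) < v_p(N)`** (so that no prime of `N m` other than `ℓ` is lost in `M`,
  `dvd_level_of_charTwist_packet_of_lt`, `dvd_level_iff_of_charTwist_packet`);
* `IsModular.isModular_twist_of_isTorsionGaloisRep` — **`E` modular, `E[ℓ] ≅ ρ̄'`, `χ ↔ ψ` as above
  with `2 v_p(m) < v_p(N_E)` at the primes `p ∣ m`, `p ≠ ℓ` ⟹ `ρ̄' ⊗ χ` is modular**; and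
  `…_twist_twist_…` for two successive twists (`m₁`, then `m₂` with `v_p(N_E) > 2 v_p(m₁) + 2 v_p(m₂)`).

In BCDT's proof `ℓ = 5`, the twists are by `ε₋₃` (`m = 3`: the condition is `27 ∣ N_E`, which
holds because `E[5] ≅ ρ̄'` is wildly ramified at `3`) and by a character ramified only at `5 = ℓ`
(no condition); see `BCDTTheoremBTwistAssembly`.

## References

* [BCDTJAMS2001] C. Breuil, B. Conrad, F. Diamond, R. Taylor, J. Amer. Math. Soc. 14 (2001),
  843–939, §2.2 (proof of Thm. 2.2.1, p. 860) and Introduction ("`ρ̄` is modular").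
* [AtkinLi1978] A. O. L. Atkin, W.-C. W. Li, *Twists of newforms and pseudo-eigenvalues of
  `W`-operators*, Invent. Math. 48 (1978), §3.
* [DiamondShurman2005] F. Diamond, J. Shurman, *A first course in modular forms*, GTM 228,
  Thm. 9.4.1, Def. 9.6.4.
-/

noncomputable section

open scoped NumberField Polynomial MatrixGroups ModularForm
open Polynomial IsDedekindDomain

universe u

namespace Literature.NumberTheory.Automorphic.BCDT

open EllipticCurves.ModularForms WeierstrassCurve Rat.HeightOneSpectrum CongruenceSubgroup
  UpperHalfPlane GaloisRepresentations Field

/-! ## Characteristic polynomials of twisted `2 × 2` matrices -/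

/-- If a `2 × 2` matrix `M` has characteristic polynomial `X² − a X + d` then `c M` has
characteristic polynomial `X² − c a X + c² d` (`tr (cM) = c tr M`, `det (cM) = c² det M`).
[folklore] -/
theorem charpoly_smul_of_charpoly_eq_fin_two {R : Type*} [CommRing R] [Nontrivial R]
    {M : Matrix (Fin 2) (Fin 2) R} {a d : R} (h : M.charpoly = X ^ 2 - C a * X + C d) (c : R) :
    (c • M).charpoly = X ^ 2 - C (c * a) * X + C (c ^ 2 * d) := by
  have h2 : X ^ 2 - C M.trace * X + C M.det = X ^ 2 - C a * X + C d :=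
    (Matrix.charpoly_fin_two M).symm.trans h
  have htr : M.trace = a := by
    have h1 := congrArg (fun P : R[X] ↦ P.coeff 1) h2
    simp only [coeff_add, coeff_sub, coeff_X_pow, coeff_C_mul, coeff_X_one, coeff_C,
      if_neg (one_ne_zero : (1 : ℕ) ≠ 0)] at h1
    norm_num at h1
    exact h1
  have hdet : M.det = d := by
    have h0 := congrArg (fun P : R[X] ↦ P.coeff 0) h2
    simp only [coeff_add, coeff_sub, coeff_X_pow, coeff_C_mul, coeff_X_zero, coeff_C_zero] at h0
    norm_num at h0
    exact h0
  rw [Matrix.charpoly_fin_two, Matrix.trace_smul, Matrix.det_smul, Fintype.card_fin, htr, hdet,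
    smul_eq_mul]

/-- **Characteristic polynomial of a twist** (rank `2`): if `charpoly ρ(g) = X² − a X + d` then
`charpoly (ρ ⊗ χ)(g) = X² − χ(g) a X + χ(g)² d`. [folklore] -/
theorem FramedRep.charpoly_twist_of_charpoly_eq {G : Type*} [Group G] [TopologicalSpace G]
    {A : Type*} [CommRing A] [TopologicalSpace A] [IsTopologicalRing A] [Nontrivial A]
    (ρ : FramedRep G A 2) (χ : G →ₜ* Aˣ) {g : G} {a d : A}
    (h : FramedRep.charpoly ρ g = X ^ 2 - C a * X + C d) :
    FramedRep.charpoly (ρ.twist χ) g = X ^ 2 - C ((χ g : A) * a) * X + C ((χ g : A) ^ 2 * d) := by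
  unfold FramedRep.charpoly at h ⊢
  rw [FramedRep.coe_twist_apply]
  exact charpoly_smul_of_charpoly_eq_fin_two h _

/-! ## An integral newform packet makes `ρ̄` modular -/

/-- A `Γ₀(M)`-newform is non-zero (`a₁ = 1`). [folklore] -/
theorem IsNewform0.ne_zero_of_isNormalized {M : ℕ} [NeZero M] {k : ℤ} {g : CuspForm (Gamma0 M) k}
    (hg : IsNewform0 g) : g ≠ 0 := by
  intro h
  have h1 : cuspCoeff g 1 = 1 := hg.2.2
  rw [h, cuspCoeff_zero_form (one_mem_strictPeriods_gamma0 M)] at h1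
  exact zero_ne_one h1

/-- **An integral newform packet makes `ρ̄` modular** (BCDT, Introduction, "`ρ̄` is modular", in
the tree's wording `ModPGaloisRep.IsModular`; Diamond–Shurman Def. 9.6.4).  Let
`g ∈ S₂(Γ₀(M))` be a newform and `b : primes → ℤ` with `a_p(g) = b_p` for every prime `p ∤ M ℓ`, and
let `ρ̄ : Γ_ℚ → GL₂(𝔽_ℓ)` be unramified at every `p ∤ M ℓ` with
`charpoly ρ̄(Frob_p) = X² − b_p X + p (mod ℓ)`.  Then `ρ̄` is modular: it is attached, through the
reduction `ι : 𝓞_g → 𝓞_g/𝔪` at a prime `𝔪 ∣ ℓ` of the coefficient ring and `𝔽_ℓ ⊆ 𝓞_g/𝔪`, to the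
newform `g ∈ S₂(Γ₁(M))` of trivial nebentypus (`isNewform1_liftToGamma1_iff_holds`), whose Hecke
polynomial at `p ∤ M ℓ` is `X² − b_p X + p ∈ ℤ[X]`.  The argument is that of the tree's
`IsModular.isModular_of_isTorsionGaloisRep` (`BCDTModularityModPProofs`), with the curve replaced by
its two consequences actually used (integral packet; unramified with the right Frobenius
polynomials away from `M ℓ`). [cite: BCDTJAMS2001, Introduction ("ρ̄ is modular")]
[cite: DiamondShurman2005, Def. 9.6.4] -/
theorem isModular_of_isNewform0_packet {M : ℕ} [NeZero M] {g : CuspForm (Gamma0 M) 2}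
    (hg : IsNewform0 g) {ℓ : ℕ} [Fact ℓ.Prime] {b : ℕ → ℤ}
    (hb : ∀ p : ℕ, p.Prime → ¬ p ∣ M * ℓ → cuspCoeff g p = (b p : ℂ))
    {ρ : ModPGaloisRep ℚ (ZMod ℓ) 2}
    (hρ : ∀ v : HeightOneSpectrum (𝓞 ℚ), ¬ ((primesEquiv v : ℕ) ∣ M * ℓ) →
      ρ.IsUnramifiedAt v ∧ ρ.HasFrobCharpolyAt v
        (X ^ 2 - C ((b (primesEquiv v : ℕ) : ℤ) : ZMod ℓ) * X + C ((primesEquiv v : ℕ) : ZMod ℓ))) :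
    ρ.IsModular := by
  classical
  have hℓp : ℓ.Prime := Fact.out
  have hgne : g ≠ 0 := IsNewform0.ne_zero_of_isNormalized hg
  -- the newform on `Γ₁(M)` with trivial character
  set f₁ : CuspForm (Gamma1 M) 2 := liftToGamma1 M 2 g with hf₁
  have hnew : IsNewform1 f₁ := (isNewform1_liftToGamma1_iff_holds M 2 g).mpr hg
  have hcoe : (⇑f₁ : ℍ → ℂ) = ⇑g := coe_liftToGamma1_holds _ 2 g
  have hε : nebentypus f₁ = 1 := nebentypus_liftToGamma1_holds _ 2 hgne
  -- a prime `𝔪` of the coefficient ring `𝓞_f` above `ℓ`, and `K = 𝓞_f / 𝔪 ⊇ 𝔽_ℓ`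
  haveI : Algebra.IsIntegral ℤ (coeffCharIntegers f₁) := by
    unfold coeffCharIntegers; infer_instance
  haveI hmax : (Ideal.span {(ℓ : ℤ)}).IsMaximal :=
    PrincipalIdealRing.isMaximal_of_irreducible (Nat.prime_iff_prime_int.mp hℓp).irreducible
  obtain ⟨𝔪, h𝔪max, h𝔪⟩ := Ideal.exists_ideal_over_maximal_of_isIntegral
    (S := coeffCharIntegers f₁) (Ideal.span {(ℓ : ℤ)}) (fun x hx ↦ by
      rw [RingHom.mem_ker, eq_intCast, Int.cast_eq_zero] at hx
      rw [hx]; exact Ideal.zero_mem _)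
  haveI : 𝔪.IsMaximal := h𝔪max
  have hℓ𝔪 : ((ℓ : ℕ) : coeffCharIntegers f₁) ∈ 𝔪 := by
    have h : ((ℓ : ℕ) : ℤ) ∈ 𝔪.comap (algebraMap ℤ (coeffCharIntegers f₁)) := by
      rw [h𝔪]; exact Ideal.mem_span_singleton_self _
    rwa [Ideal.mem_comap, map_natCast] at h
  let K : Type := coeffCharIntegers f₁ ⧸ 𝔪
  letI : Field K := Ideal.Quotient.field 𝔪
  letI : TopologicalSpace K := ⊥
  haveI : DiscreteTopology K := ⟨rfl⟩
  have hℓK : ((ℓ : ℕ) : K) = 0 := by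
    rw [← map_natCast (Ideal.Quotient.mk 𝔪), Ideal.Quotient.eq_zero_iff_mem]
    exact hℓ𝔪
  haveI : CharP K ℓ := (CharP.charP_iff_prime_eq_zero hℓp).mpr hℓK
  let j : ZMod ℓ →+* K := ZMod.castHom (dvd_refl ℓ) K
  let ι : coeffCharIntegers f₁ →+* K := Ideal.Quotient.mk 𝔪
  refine ⟨M, inferInstance, 2, f₁, K, inferInstance, inferInstance, inferInstance, j, ι, by norm_num,
    hnew, ?_⟩
  -- `ρ̄ ⊗ K` is attached to `f₁` away from `M ℓ`
  intro v hv
  have hpp : (primesEquiv v : ℕ).Prime := (primesEquiv v).2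
  rw [ZMod.ringChar_zmod_n] at hv
  have hv' : ¬ ((primesEquiv v : ℕ) ∣ M * ℓ) := hv
  have hpM : ¬ (primesEquiv v : ℕ) ∣ M := fun h ↦ hv' (dvd_mul_of_dvd_left h _)
  obtain ⟨hunr, hfrob⟩ := hρ v hv'
  refine ⟨?_, ?_⟩
  · -- unramified at `p`
    intro 𝔓 h𝔓 τ hτ
    rw [FramedRep.baseChange_apply, hunr 𝔓 h𝔓 τ hτ, map_one]
  · -- the Hecke polynomial `X² - b_p X + p`, integrally, and the Frobenius characteristic polynomial
    have hap : (qExpansion 1 ⇑f₁).coeff (primesEquiv v : ℕ) = ((b (primesEquiv v : ℕ) : ℤ) : ℂ) := by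
      rw [hcoe]; exact hb _ hpp hv'
    have hεp : (nebentypus f₁ ((primesEquiv v : ℕ) : ZMod M) : ℂ) *
        ((primesEquiv v : ℕ) : ℂ) ^ ((2 : ℤ) - 1) = ((primesEquiv v : ℕ) : ℂ) := by
      rw [hε, MulChar.one_apply ((ZMod.isUnit_prime_iff_not_dvd hpp).mpr hpM), one_mul]
      norm_num
    have h1 : (⟨(qExpansion 1 ⇑f₁).coeff (primesEquiv v : ℕ),
        cuspCoeff_mem_coeffCharField f₁ (primesEquiv v : ℕ)⟩ : coeffCharField f₁) =
        ((b (primesEquiv v : ℕ) : ℤ) : coeffCharField f₁) :=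
      Subtype.ext (by
        change PowerSeries.coeff _ (qExpansion 1 ⇑f₁) = _
        rw [hap]; norm_cast)
    have h2 : (⟨(nebentypus f₁ ((primesEquiv v : ℕ) : ZMod M) : ℂ) *
        ((primesEquiv v : ℕ) : ℂ) ^ ((2 : ℤ) - 1),
        nebentypus_mul_zpow_mem_coeffCharField f₁ (primesEquiv v : ℕ)⟩ : coeffCharField f₁) =
        ((primesEquiv v : ℕ) : coeffCharField f₁) :=
      Subtype.ext (by
        change (nebentypus f₁ ((primesEquiv v : ℕ) : ZMod M) : ℂ) *
          ((primesEquiv v : ℕ) : ℂ) ^ ((2 : ℤ) - 1) = _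
        rw [hεp]; norm_cast)
    refine ⟨X ^ 2 - C ((b (primesEquiv v : ℕ) : ℤ) : coeffCharIntegers f₁) * X +
      C ((primesEquiv v : ℕ) : coeffCharIntegers f₁), ?_, ?_⟩
    · rw [Polynomial.map_add, Polynomial.map_sub, Polynomial.map_mul, Polynomial.map_pow,
        Polynomial.map_X, Polynomial.map_C, Polynomial.map_C, map_intCast, map_natCast,
        heckePolynomial, h1, h2]
    · intro 𝔓 h𝔓 σ hσ
      have hch := hfrob 𝔓 h𝔓 σ hσ
      have hmap : (Units.val (Matrix.GeneralLinearGroup.map j (ρ σ)) : Matrix (Fin 2) (Fin 2) K) =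
          ((ρ σ : GL (Fin 2) (ZMod ℓ)) : Matrix (Fin 2) (Fin 2) (ZMod ℓ)).map j := rfl
      simp only [FramedRep.charpoly, FramedRep.baseChange_apply] at hch ⊢
      rw [hmap, Matrix.charpoly_map, hch]
      simp only [Polynomial.map_add, Polynomial.map_sub, Polynomial.map_mul, Polynomial.map_pow,
        Polynomial.map_X, Polynomial.map_C]
      rw [map_intCast j, map_natCast j, map_intCast ι, map_natCast ι]

/-! ## A modular elliptic curve gives an integral packet for `E[ℓ]` -/

/-- **The integral packet of a modular elliptic curve**: for `E / ℚ` modular (`IsModular W`: the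
newform `f ∈ S₂(Γ₀(N_E))` with `aₙ(f) = aₙ(E)`), a prime `ℓ` and any framed model `ρ̄` of `E[ℓ]`,
`f` is a newform with the integral packet `a_p(E)`, and `ρ̄` is unramified at every prime
`p ∤ N_E ℓ` (good reduction, Néron–Ogg–Shafarevich, Silverman VII.4.1) with
`charpoly ρ̄(Frob_p) = X² − a_p(E) X + p (mod ℓ)` (Diamond–Shurman Thm. 9.4.1, proof; the trace of
Frobenius on `T_ℓ E` granted as `htr`, the determinant taken from the Weil pairing).  This is the
curve-dependent half of the tree's `IsModular.isModular_of_isTorsionGaloisRep'`.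
[cite: DiamondShurman2005, Thm. 9.4.1] [cite: BCDTJAMS2001, §2.2 (proof of Thm. 2.2.1)] -/
theorem IsModular.exists_isNewform0_packet {W : WeierstrassCurve ℚ} [W.IsElliptic]
    [NeZero (W.conductorNorm ℤ)] (hE : IsModular W) {ℓ : ℕ} [Fact ℓ.Prime]
    (htr : W.trace_galoisRepTate_frobenius_of_hasGoodReductionAt ℓ)
    {ρ : ModPGaloisRep ℚ (ZMod ℓ) 2} (hρ : W.IsTorsionGaloisRep ℓ ρ) :
    ∃ f : CuspForm (Gamma0 (W.conductorNorm ℤ)) 2, IsNewform0 f ∧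
      (∀ p : ℕ, p.Prime → ¬ p ∣ W.conductorNorm ℤ * ℓ → cuspCoeff f p = ((W.LFunction p : ℤ) : ℂ)) ∧
      ∀ v : HeightOneSpectrum (𝓞 ℚ), ¬ ((primesEquiv v : ℕ) ∣ W.conductorNorm ℤ * ℓ) →
        ρ.IsUnramifiedAt v ∧ ρ.HasFrobCharpolyAt v
          (X ^ 2 - C (((W.LFunction (primesEquiv v : ℕ) : ℤ)) : ZMod ℓ) * X +
            C ((primesEquiv v : ℕ) : ZMod ℓ)) := by
  have hℓp : ℓ.Prime := Fact.out
  obtain ⟨f, hf0, hcoef⟩ := hE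
  have hdet : W.det_galoisRepTate_frobenius_of_hasGoodReductionAt ℓ :=
    det_galoisRepTate_frobenius_of_hasGoodReductionAt_of_exists_weilPairing
      fun _ ↦ W.exists_weilPairing_holds _
  refine ⟨f, hf0, fun p _ _ ↦ hcoef p, fun v hv ↦ ?_⟩
  have hpp : (primesEquiv v : ℕ).Prime := (primesEquiv v).2
  have hpN : ¬ (primesEquiv v : ℕ) ∣ W.conductorNorm ℤ := fun h ↦ hv (dvd_mul_of_dvd_left h _)
  have hpℓ : (primesEquiv v : ℕ) ≠ ℓ := fun h ↦ hv (by rw [← h]; exact dvd_mul_left _ _)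
  have hgood : W.HasGoodReductionAt v := by
    by_contra h
    exact hpN ((W.dvd_conductorNorm_iff v).mpr h)
  have hℓv : ((ℓ : ℕ) : 𝓞 ℚ) ∉ v.asIdeal := by
    rw [Literature.NumberTheory.GaloisRepresentations.Rat.natCast_mem_asIdeal_iff]
    exact fun h ↦ hpℓ ((Nat.prime_dvd_prime_iff_eq hpp hℓp).mp h)
  refine ⟨hρ.isUnramifiedAt_of_hasGoodReductionAt hgood hℓv, ?_⟩
  intro 𝔓 h𝔓 σ hσ
  have hch := hρ.charpoly_eq_of_isArithFrobAt htr hdet hℓv hgood h𝔓 hσ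
  rw [natCard_residueField_adicCompletionIntegers,
    ← W.lFunction_primesEquiv_eq_frobeniusTraceAt hgood] at hch
  exact hch

/-! ## The twist step -/

/-- **The twist step.**  Let `f ∈ S₂(Γ₀(N))` be a newform with integral packet `a_p = a(p) ∈ ℤ`
(`p ∤ N ℓ`) carried by `ρ̄ : Γ_ℚ → GL₂(𝔽_ℓ)` (unramified, `charpoly ρ̄(Frob_p) = X² − a_p X + p`, at
every `p ∤ N ℓ`); let `ψ mod m` be a primitive quadratic Dirichlet character and
`χ : Γ_ℚ → 𝔽_ℓ^×` a continuous character **matching `ψ`**: trivial on the inertia groups above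
every `p ∤ m`, and `χ(Frob_p) = ψ(p) ∈ {±1}` there; and assume `2 v_p(m) < v_p(N)` for every prime
`p ∣ m`, `p ≠ ℓ`.  Then the newform `g` attached to `f ⊗ ψ` (`exists_isNewform0_charTwist_packet`:
level `M`, `M ∣ N m²`, `N ∣ M m²`, `a_p(g) = ψ(p) a_p` for `p ∤ N m`) carries `ρ̄ ⊗ χ` in the same
sense: every prime `p ∤ M ℓ` satisfies `p ∤ N m` (`dvd_level_of_charTwist_packet_of_lt`,
`dvd_level_iff_of_charTwist_packet`), where `ρ̄ ⊗ χ` is unramified with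
`charpoly (ρ̄ ⊗ χ)(Frob_p) = X² − χ(Frob_p) a_p X + χ(Frob_p)² p = X² − ψ(p) a_p X + p`.
This is the content of "modularity is preserved by quadratic twists" in BCDT's use (§2.2, p. 860).
[cite: BCDTJAMS2001, §2.2 (proof of Thm. 2.2.1, p. 860)] [cite: AtkinLi1978, §3] -/
theorem exists_isNewform0_packet_twist {N : ℕ} [NeZero N] {f : CuspForm (Gamma0 N) 2}
    (hf : IsNewform0 f) {ℓ : ℕ} [Fact ℓ.Prime] {a : ℕ → ℤ}
    (ha : ∀ p : ℕ, p.Prime → ¬ p ∣ N * ℓ → cuspCoeff f p = (a p : ℂ))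
    {ρ : ModPGaloisRep ℚ (ZMod ℓ) 2}
    (hρ : ∀ v : HeightOneSpectrum (𝓞 ℚ), ¬ ((primesEquiv v : ℕ) ∣ N * ℓ) →
      ρ.IsUnramifiedAt v ∧ ρ.HasFrobCharpolyAt v
        (X ^ 2 - C ((a (primesEquiv v : ℕ) : ℤ) : ZMod ℓ) * X + C ((primesEquiv v : ℕ) : ZMod ℓ)))
    {m : ℕ} [NeZero m] {ψ : DirichletCharacter ℂ m} (hψ : ψ.IsQuadratic) (hprim : ψ.IsPrimitive)
    (χ : absoluteGaloisGroup ℚ →ₜ* (ZMod ℓ)ˣ)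
    (hχI : ∀ v : HeightOneSpectrum (𝓞 ℚ), ¬ ((primesEquiv v : ℕ) ∣ m) →
      ∀ 𝔓 ∈ v.primesAbove, ∀ τ ∈ 𝔓.inertia (absoluteGaloisGroup ℚ), χ τ = 1)
    (hχF : ∀ v : HeightOneSpectrum (𝓞 ℚ), ¬ ((primesEquiv v : ℕ) ∣ m) →
      ∀ 𝔓 ∈ v.primesAbove, ∀ σ : absoluteGaloisGroup ℚ, IsArithFrobAt (𝓞 ℚ) σ 𝔓 →
        (ψ (primesEquiv v : ℕ) = 1 → χ σ = 1) ∧ (ψ (primesEquiv v : ℕ) = -1 → χ σ = -1))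
    (hsupp : ∀ p : ℕ, p.Prime → p ∣ m → p ≠ ℓ → 2 * m.factorization p < N.factorization p) :
    ∃ (M : ℕ) (_ : NeZero M) (_ : M ∣ N * m ^ 2) (_ : N ∣ M * m ^ 2) (g : CuspForm (Gamma0 M) 2)
      (b : ℕ → ℤ), IsNewform0 g ∧
      (∀ p : ℕ, p.Prime → ¬ p ∣ M * ℓ → cuspCoeff g p = (b p : ℂ)) ∧
      ∀ v : HeightOneSpectrum (𝓞 ℚ), ¬ ((primesEquiv v : ℕ) ∣ M * ℓ) →
        FramedGaloisRep.IsUnramifiedAt v (ρ.twist χ) ∧ FramedGaloisRep.HasFrobCharpolyAt v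
          (X ^ 2 - C ((b (primesEquiv v : ℕ) : ℤ) : ZMod ℓ) * X + C ((primesEquiv v : ℕ) : ZMod ℓ))
          (ρ.twist χ) := by
  classical
  have hℓp : ℓ.Prime := Fact.out
  obtain ⟨M, _, hMN, hNM, g, hg, hpk⟩ := exists_isNewform0_charTwist_packet hψ hprim hf
  -- the primes `p ∤ M ℓ` divide neither `N` nor `m`
  have hkey : ∀ p : ℕ, p.Prime → ¬ p ∣ M * ℓ → ¬ p ∣ N ∧ ¬ p ∣ m ∧ p ≠ ℓ := by
    intro p hp hpMℓ
    have hpM : ¬ p ∣ M := fun h ↦ hpMℓ (dvd_mul_of_dvd_left h _)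
    have hpℓ : p ≠ ℓ := fun h ↦ hpMℓ (h ▸ dvd_mul_left _ _)
    have hpm : ¬ p ∣ m := fun h ↦
      hpM (dvd_level_of_charTwist_packet_of_lt (NeZero.ne M) hNM (hsupp p hp h hpℓ))
    exact ⟨fun h ↦ hpM ((dvd_level_iff_of_charTwist_packet hMN hNM hp hpm).mpr h), hpm, hpℓ⟩
  -- `ψ(p) = ±1` at the primes `p ∤ m`
  have hψpm : ∀ p : ℕ, p.Prime → ¬ p ∣ m → ψ p = 1 ∨ ψ p = -1 := by
    intro p hp hpm
    have hunit : IsUnit ((p : ℕ) : ZMod m) := (ZMod.isUnit_prime_iff_not_dvd hp).mpr hpm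
    have hsq : ψ p ^ 2 = 1 := apply_sq_eq_one_of_isQuadratic hψ hunit
    rcases hψ (p : ZMod m) with h | h | h
    · rw [h] at hsq; norm_num at hsq
    · exact Or.inl h
    · exact Or.inr h
  let b : ℕ → ℤ := fun p ↦ if ψ p = 1 then a p else -(a p)
  have hb_of_one : ∀ p : ℕ, ψ p = 1 → b p = a p := fun p h ↦ by simp [b, h]
  have hb_of_neg : ∀ p : ℕ, ψ p = -1 → b p = -(a p) := fun p h ↦ by
    have : ψ p ≠ 1 := by rw [h]; norm_num
    simp [b, this]
  refine ⟨M, inferInstance, hMN, hNM, g, b, hg, fun p hp hpMℓ ↦ ?_, fun v hv ↦ ?_⟩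
  · -- the packet of `g` away from `M ℓ` is `ψ(p) a_p ∈ ℤ`
    obtain ⟨hpN, hpm, hpℓ⟩ := hkey p hp hpMℓ
    have hpNm : ¬ p ∣ N * m ^ 2 := fun h ↦
      (hp.dvd_mul.mp h).elim hpN fun h' ↦ hpm (hp.dvd_of_dvd_pow h')
    have hpNℓ : ¬ p ∣ N * ℓ := fun h ↦
      (hp.dvd_mul.mp h).elim hpN fun h' ↦ hpℓ ((Nat.prime_dvd_prime_iff_eq hp hℓp).mp h')
    rw [hpk p hp hpNm, ha p hp hpNℓ]
    rcases hψpm p hp hpm with h1 | h1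
    · rw [h1, hb_of_one p h1, one_mul]
    · rw [h1, hb_of_neg p h1, Int.cast_neg, neg_one_mul]
  · -- the Galois side at `p ∤ M ℓ`
    have hpp : (primesEquiv v : ℕ).Prime := (primesEquiv v).2
    obtain ⟨hpN, hpm, hpℓ⟩ := hkey _ hpp hv
    have hpNℓ : ¬ (primesEquiv v : ℕ) ∣ N * ℓ := fun h ↦
      (hpp.dvd_mul.mp h).elim hpN fun h' ↦ hpℓ ((Nat.prime_dvd_prime_iff_eq hpp hℓp).mp h')
    obtain ⟨hunr, hfrob⟩ := hρ v hpNℓ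
    refine ⟨fun 𝔓 h𝔓 τ hτ ↦ ?_, fun 𝔓 h𝔓 σ hσ ↦ ?_⟩
    · rw [FramedRep.twist_apply_of_eq_one ρ χ (hχI v hpm 𝔓 h𝔓 τ hτ), hunr 𝔓 h𝔓 τ hτ]
    · have htw := FramedRep.charpoly_twist_of_charpoly_eq ρ χ (hfrob 𝔓 h𝔓 σ hσ)
      obtain ⟨hF1, hF2⟩ := hχF v hpm 𝔓 h𝔓 σ hσ
      rw [htw]
      rcases hψpm _ hpp hpm with h1 | h1
      · rw [hF1 h1, hb_of_one _ h1, Units.val_one, one_mul, one_pow, one_mul]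
      · rw [hF2 h1, hb_of_neg _ h1, Units.val_neg, Units.val_one, Int.cast_neg, neg_one_mul,
          neg_one_sq, one_mul]

/-! ## `E` modular ⇒ a matched quadratic twist of `ρ̄_{E,ℓ}` is modular -/

/-- **`E` modular, `E[ℓ] ≅ ρ̄'` ⟹ `ρ̄' ⊗ χ` modular** for a continuous `χ : Γ_ℚ → 𝔽_ℓ^×` matching a
primitive quadratic Dirichlet character `ψ mod m` (trivial on inertia above `p ∤ m`,
`χ(Frob_p) = ψ(p)`), provided `2 v_p(m) < v_p(N_E)` at every prime `p ∣ m`, `p ≠ ℓ`: BCDT's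
"twisting by a quadratic character" (§2.2, p. 860) in the tree's wording of modularity.  Chain
`IsModular.exists_isNewform0_packet` → `exists_isNewform0_packet_twist` →
`isModular_of_isNewform0_packet`; granted only the trace of Frobenius on `T_ℓ E` (`htr`, Silverman
C.21.3), as in `IsModular.isModular_of_isTorsionGaloisRep'`.
[cite: BCDTJAMS2001, §2.2 (proof of Thm. 2.2.1, p. 860)] -/
theorem IsModular.isModular_twist_of_isTorsionGaloisRep {W : WeierstrassCurve ℚ} [W.IsElliptic]
    [NeZero (W.conductorNorm ℤ)] (hE : IsModular W) {ℓ : ℕ} [Fact ℓ.Prime]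
    (htr : W.trace_galoisRepTate_frobenius_of_hasGoodReductionAt ℓ)
    {ρ : ModPGaloisRep ℚ (ZMod ℓ) 2} (hρ : W.IsTorsionGaloisRep ℓ ρ)
    {m : ℕ} [NeZero m] {ψ : DirichletCharacter ℂ m} (hψ : ψ.IsQuadratic) (hprim : ψ.IsPrimitive)
    (χ : absoluteGaloisGroup ℚ →ₜ* (ZMod ℓ)ˣ)
    (hχI : ∀ v : HeightOneSpectrum (𝓞 ℚ), ¬ ((primesEquiv v : ℕ) ∣ m) →
      ∀ 𝔓 ∈ v.primesAbove, ∀ τ ∈ 𝔓.inertia (absoluteGaloisGroup ℚ), χ τ = 1)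
    (hχF : ∀ v : HeightOneSpectrum (𝓞 ℚ), ¬ ((primesEquiv v : ℕ) ∣ m) →
      ∀ 𝔓 ∈ v.primesAbove, ∀ σ : absoluteGaloisGroup ℚ, IsArithFrobAt (𝓞 ℚ) σ 𝔓 →
        (ψ (primesEquiv v : ℕ) = 1 → χ σ = 1) ∧ (ψ (primesEquiv v : ℕ) = -1 → χ σ = -1))
    (hsupp : ∀ p : ℕ, p.Prime → p ∣ m → p ≠ ℓ →
      2 * m.factorization p < (W.conductorNorm ℤ).factorization p) :
    ModPGaloisRep.IsModular (ρ.twist χ) := by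
  obtain ⟨f, hf, ha, hρ'⟩ := hE.exists_isNewform0_packet htr hρ
  obtain ⟨M, _, -, -, g, b, hg, hb, hgal⟩ :=
    exists_isNewform0_packet_twist hf ha hρ' hψ hprim χ hχI hχF hsupp
  exact isModular_of_isNewform0_packet hg hb hgal

/-- **Two successive matched quadratic twists** (`ψ₁ mod m₁` then `ψ₂ mod m₂`): `E` modular,
`E[ℓ] ≅ ρ̄'`, and `2 v_p(m₁) < v_p(N_E)` for `p ∣ m₁`, `2 v_p(m₁) + 2 v_p(m₂) < v_p(N_E)` for `p ∣ m₂`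
(`p ≠ ℓ`) ⟹ `(ρ̄' ⊗ χ₁) ⊗ χ₂` is modular (the level after the first twist still has
`v_p ≥ v_p(N_E) − 2 v_p(m₁)`, from `N_E ∣ M₁ m₁²`).  In BCDT's use `m₂ = 5 = ℓ` and the second
condition is void. [cite: BCDTJAMS2001, §2.2 (proof of Thm. 2.2.1, p. 860)] -/
theorem IsModular.isModular_twist_twist_of_isTorsionGaloisRep {W : WeierstrassCurve ℚ}
    [W.IsElliptic] [NeZero (W.conductorNorm ℤ)] (hE : IsModular W) {ℓ : ℕ} [Fact ℓ.Prime]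
    (htr : W.trace_galoisRepTate_frobenius_of_hasGoodReductionAt ℓ)
    {ρ : ModPGaloisRep ℚ (ZMod ℓ) 2} (hρ : W.IsTorsionGaloisRep ℓ ρ)
    {m₁ : ℕ} [NeZero m₁] {ψ₁ : DirichletCharacter ℂ m₁} (hψ₁ : ψ₁.IsQuadratic)
    (hprim₁ : ψ₁.IsPrimitive) (χ₁ : absoluteGaloisGroup ℚ →ₜ* (ZMod ℓ)ˣ)
    (hχI₁ : ∀ v : HeightOneSpectrum (𝓞 ℚ), ¬ ((primesEquiv v : ℕ) ∣ m₁) →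
      ∀ 𝔓 ∈ v.primesAbove, ∀ τ ∈ 𝔓.inertia (absoluteGaloisGroup ℚ), χ₁ τ = 1)
    (hχF₁ : ∀ v : HeightOneSpectrum (𝓞 ℚ), ¬ ((primesEquiv v : ℕ) ∣ m₁) →
      ∀ 𝔓 ∈ v.primesAbove, ∀ σ : absoluteGaloisGroup ℚ, IsArithFrobAt (𝓞 ℚ) σ 𝔓 →
        (ψ₁ (primesEquiv v : ℕ) = 1 → χ₁ σ = 1) ∧ (ψ₁ (primesEquiv v : ℕ) = -1 → χ₁ σ = -1))
    (hsupp₁ : ∀ p : ℕ, p.Prime → p ∣ m₁ → p ≠ ℓ →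
      2 * m₁.factorization p < (W.conductorNorm ℤ).factorization p)
    {m₂ : ℕ} [NeZero m₂] {ψ₂ : DirichletCharacter ℂ m₂} (hψ₂ : ψ₂.IsQuadratic)
    (hprim₂ : ψ₂.IsPrimitive) (χ₂ : absoluteGaloisGroup ℚ →ₜ* (ZMod ℓ)ˣ)
    (hχI₂ : ∀ v : HeightOneSpectrum (𝓞 ℚ), ¬ ((primesEquiv v : ℕ) ∣ m₂) →
      ∀ 𝔓 ∈ v.primesAbove, ∀ τ ∈ 𝔓.inertia (absoluteGaloisGroup ℚ), χ₂ τ = 1)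
    (hχF₂ : ∀ v : HeightOneSpectrum (𝓞 ℚ), ¬ ((primesEquiv v : ℕ) ∣ m₂) →
      ∀ 𝔓 ∈ v.primesAbove, ∀ σ : absoluteGaloisGroup ℚ, IsArithFrobAt (𝓞 ℚ) σ 𝔓 →
        (ψ₂ (primesEquiv v : ℕ) = 1 → χ₂ σ = 1) ∧ (ψ₂ (primesEquiv v : ℕ) = -1 → χ₂ σ = -1))
    (hsupp₂ : ∀ p : ℕ, p.Prime → p ∣ m₂ → p ≠ ℓ →
      2 * m₁.factorization p + 2 * m₂.factorization p < (W.conductorNorm ℤ).factorization p) :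
    ModPGaloisRep.IsModular ((ρ.twist χ₁).twist χ₂) := by
  obtain ⟨f, hf, ha, hρ'⟩ := hE.exists_isNewform0_packet htr hρ
  obtain ⟨M₁, _, -, hNM₁, g₁, b₁, hg₁, hb₁, hgal₁⟩ :=
    exists_isNewform0_packet_twist hf ha hρ' hψ₁ hprim₁ χ₁ hχI₁ hχF₁ hsupp₁
  have hsupp₂' : ∀ p : ℕ, p.Prime → p ∣ m₂ → p ≠ ℓ →
      2 * m₂.factorization p < M₁.factorization p := by
    intro p hp hpm hpℓ
    have hm₁ : m₁ ≠ 0 := NeZero.ne m₁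
    have h1 : (W.conductorNorm ℤ).factorization p ≤ (M₁ * m₁ ^ 2).factorization p :=
      (Nat.factorization_le_iff_dvd (NeZero.ne _)
        (mul_ne_zero (NeZero.ne M₁) (pow_ne_zero 2 hm₁))).mpr hNM₁ p
    rw [Nat.factorization_mul (NeZero.ne M₁) (pow_ne_zero 2 hm₁), Finsupp.add_apply,
      Nat.factorization_pow, Finsupp.smul_apply, smul_eq_mul] at h1
    have h2 := hsupp₂ p hp hpm hpℓ
    omega
  obtain ⟨M₂, _, -, -, g₂, b₂, hg₂, hb₂, hgal₂⟩ :=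
    exists_isNewform0_packet_twist hg₁ hb₁ hgal₁ hψ₂ hprim₂ χ₂ hχI₂ hχF₂ hsupp₂'
  exact isModular_of_isNewform0_packet hg₂ hb₂ hgal₂

end Literature.NumberTheory.Automorphic.BCDT

end
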